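import Summits.AnomalousDissipation.AnomalousDissipation.Theses.TwoAndHalfD
import Summits.AnomalousDissipation.AnomalousDissipation.Theorems.TwoAndHalfDScalarAnomalySteadySourceFormalColdStartVarianceToolkit
import Literature.Analysis.FluidPDE.PassiveScalarWellPosednessProofs
import Literature.Analysis.FluidPDE.PassiveScalarClassicalEnergy
import Literature.Analysis.FluidPDE.TorusHeatForcedIcc

/-!
# S3 `stub_inputPowerFloor`: the cold-start input-power floor survives iterated halving

Stub S3 of the line `budgeted-mixer-template` for the crux
`Summit.AnomalousDissipation.AnomalousDissipation.Theses.TwoAndHalfD.ScalarAnomalySteadySourceFormal`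
(stmt-AnomalousDissipation-0448); the statement is registered verbatim in the line's checked
skeleton (`Cruxes/ScalarAnomalySteadySourceFormal/Lines/budgeted-mixer-template.lean`) and is
consumed by the kernel-checked composition `ScalarAnomalySteadySourceFormal_of` there.

CONTENT. For `κ > 0`, `τ > 0`, `n ≥ 1`, a jointly smooth divergence-free drift `u` on
`T² × [0, ∞)`, a smooth profile `h` and a class `S` of profiles with
(small) `4τ‖h‖² ≤ 2ⁿc₀`, (Half) every classical release on `[s, s + τ]`, `s ≥ 0`, with datum in
`S` loses three quarters of `‖·‖²_{L²}`, (Inv-0) releases with datum in `S` stay in `S`, and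
(Floor) every classical `h`-sourced solution on `[s, s + nτ]`, `s ≥ 0`, from the zero datum has
`∫ h·ρ(s + nτ) ≥ c₀`: every global classical cold start `θ` (source `h`, on `[0, ∞)`) that stays in
`S` and obeys the restart bound `‖θ(t)‖² ≤ 4τ²‖h‖²` has `∫ h θ(t) ≥ c₀/2` for all `t ≥ nτ`.

PROOF. For `t = s + nτ`, `s ≥ 0`, split `θ = φ + ρ` on `[s, t]` with `φ` the classical release
from `θ(s)` (`exists_release_Icc`: the tree's existence theorem
`Torus.exists_isClassicalScalarTransportForcedOn` after the time shift `u(· + s)`, as in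
`ColdStartVariance.exists_release`) and `ρ = θ - φ` the cold start at `s` (toolkit
`ColdStartVariance.forced_restrict`, `forced_sub_unforced`), so `∫ h·ρ(t) ≥ c₀` by (Floor);
`sqrt_scalarL2Sq_release_le` — ITERATED HALVING: by (Inv-0) and (Half) on the sub-windows
`[s + kτ, s + (k+1)τ]` (`IsClassicalScalarTransportOn.restrict_Icc`),
`‖φ(s + kτ)‖ ≤ 2^{-k}‖θ(s)‖ ≤ 2^{-k}·2τ‖h‖`; Cauchy–Schwarz
(`integral_mul_le_sqrt_mul_sqrt`) and (small) give `-∫ h·φ(t) ≤ 2^{-n}·2τ‖h‖² ≤ c₀/2`, whence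
`∫ h·θ(t) = ∫ h·φ(t) + ∫ h·ρ(t) ≥ c₀/2`.
Supports stmt-AnomalousDissipation-0448. [folklore: Green–Kubo / no-revival, card K3]
-/

-- the summit path `AnomalousDissipation/AnomalousDissipation` duplicates a namespace component
set_option linter.dupNamespace false

noncomputable section

namespace Summit.AnomalousDissipation.AnomalousDissipation.Theorems.ScalarAnomalySteadySourceFormal.InputPowerFloor

open MeasureTheory Filter Topology
open scoped ENNReal NNReal
open Literature.Analysis.FunctionSpaces Literature.Analysis.FluidPDE
open Summit.AnomalousDissipation.AnomalousDissipation.Theorems.ScalarAnomalySteadySourceFormal.ColdStartVariance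

/-! ## Releases at a later time -/

/-- **Releases at time `s ≥ 0`.** For `κ > 0`, `T > 0`, a drift jointly smooth and divergence
free on `[0, ∞) × T²` and a smooth datum `ψ`, there is a classical solution `φ` of the unforced
equation `∂ₜφ + u·∇φ = κΔφ` on `[s, s + T]` with `φ(s) = ψ`: apply the tree's existence theorem
`Torus.exists_isClassicalScalarTransportForcedOn` (source `0`) on `[0, T]` to the time-shifted
drift `u(· + s)` and shift the solution back (`Torus.timeDerivWithin_comp_add_const`). (Same
statement and proof as `ColdStartVariance.exists_release` of the S2 file, repeated here to keep
this file independent of it.) [folklore] -/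
theorem exists_release_Icc {κ T s : ℝ} {u : ℝ → UnitAddTorus (Fin 2) → EuclideanSpace ℝ (Fin 2)}
    {ψ : UnitAddTorus (Fin 2) → ℝ} (hκ : 0 < κ) (hT : 0 < T)
    (hu : Torus.IsSmoothSpaceTimeOn (Set.Ici 0) u)
    (hdiv : ∀ t ∈ Set.Ici (0 : ℝ), Torus.IsDivFree (u t)) (hs : 0 ≤ s) (hψ : Torus.IsSmooth ψ) :
    ∃ φ : ℝ → UnitAddTorus (Fin 2) → ℝ,
      Torus.IsClassicalScalarTransportOn (Set.Icc s (s + T)) κ u φ ∧ φ s = ψ := by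
  -- the shifted drift on `[0, T]`
  have hu' : Torus.IsSmoothSpaceTimeOn (Set.Icc 0 T) (fun t => u (t + s)) :=
    (hu.comp_add_const s).mono fun t ht => show 0 ≤ t + s from add_nonneg ht.1 hs
  have hdiv' : ∀ t ∈ Set.Icc 0 T, Torus.IsDivFree ((fun t => u (t + s)) t) := fun t ht =>
    hdiv (t + s) (show 0 ≤ t + s from add_nonneg ht.1 hs)
  have h0 : Torus.IsSmoothSpaceTimeOn (Set.Icc 0 T)
      (fun (_ : ℝ) (_ : UnitAddTorus (Fin 2)) => (0 : ℝ)) :=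
    Torus.isSmoothSpaceTimeOn_const (Torus.isSmooth_const _) _
  obtain ⟨φ', hφ', hφ'0⟩ :=
    Torus.exists_isClassicalScalarTransportForcedOn hκ hT hu' hdiv' h0 hψ
  have hpre : (· + -s) ⁻¹' Set.Icc 0 T = Set.Icc s (s + T) := by
    rw [Torus.preimage_add_const_Icc']
    congr 1 <;> ring
  refine ⟨fun t => φ' (t + -s), ⟨hu.mono fun t ht => hs.trans ht.1, ?_, fun t ht x => ?_,
    fun t ht => hdiv t (hs.trans ht.1)⟩, ?_⟩
  · have h := hφ'.smooth_scalar.comp_add_const (-s)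
    rwa [hpre] at h
  · have h1 := Torus.timeDerivWithin_comp_add_const (Set.Icc 0 T) φ' (-s) t x
    rw [hpre] at h1
    rw [h1]
    have ht' : t + -s ∈ Set.Icc 0 T := ⟨by linarith [ht.1], by linarith [ht.2]⟩
    have h2 := hφ'.transport (t + -s) ht' x
    rw [neg_add_cancel_right, add_zero] at h2
    exact h2
  · funext x
    simp [hφ'0]

/-! ## Iterated halving of a release -/

/-- **Iterated halving.** If every classical release on `[r, r + τ]`, `r ≥ 0`, with datum in `S`
loses three quarters of its `L²` norm squared (Half) and releases with datum in `S` stay in `S`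
(Inv-0), then a classical release `φ` on `[s, T']`, `s ≥ 0`, with `φ(s) ∈ S` satisfies
`‖φ(s + kτ)‖_{L²} ≤ 2^{-k}‖φ(s)‖_{L²}` as long as `s + kτ ≤ T'` (induction on `k`: restrict `φ`
to the sub-window `[s + kτ, s + (k+1)τ]`, `IsClassicalScalarTransportOn.restrict_Icc`, where its
datum `φ(s + kτ)` lies in `S` by (Inv-0), and apply (Half)). [folklore] -/
theorem sqrt_scalarL2Sq_release_le {κ τ s T' : ℝ}
    {u : ℝ → UnitAddTorus (Fin 2) → EuclideanSpace ℝ (Fin 2)}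
    {S : Set (UnitAddTorus (Fin 2) → ℝ)} {φ : ℝ → UnitAddTorus (Fin 2) → ℝ}
    (hτ : 0 < τ) (hs : 0 ≤ s)
    (hHalf : ∀ (s : ℝ), 0 ≤ s → ∀ φ : ℝ → UnitAddTorus (Fin 2) → ℝ,
        Torus.IsClassicalScalarTransportOn (Set.Icc s (s + τ)) κ u φ → φ s ∈ S →
        Torus.scalarL2Sq (φ (s + τ)) ≤ 4⁻¹ * Torus.scalarL2Sq (φ s))
    (hInv0 : ∀ (s T' : ℝ), 0 ≤ s → ∀ φ : ℝ → UnitAddTorus (Fin 2) → ℝ,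
        Torus.IsClassicalScalarTransportOn (Set.Icc s T') κ u φ → φ s ∈ S →
        ∀ t ∈ Set.Icc s T', φ t ∈ S)
    (hφ : Torus.IsClassicalScalarTransportOn (Set.Icc s T') κ u φ) (hφs : φ s ∈ S) :
    ∀ k : ℕ, s + k * τ ≤ T' →
      √(Torus.scalarL2Sq (φ (s + k * τ))) ≤ (2⁻¹ : ℝ) ^ k * √(Torus.scalarL2Sq (φ s)) := by
  intro k
  induction k with
  | zero =>
    intro _
    simp
  | succ k ih =>
    intro hk1
    push_cast at hk1 ⊢
    -- the sub-window `[r, r + τ]`, `r = s + kτ`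
    set r : ℝ := s + k * τ with hr_def
    have hkτ : 0 ≤ (k : ℝ) * τ := mul_nonneg k.cast_nonneg hτ.le
    have hr0 : 0 ≤ r := add_nonneg hs hkτ
    have hsr : s ≤ r := le_add_of_nonneg_right hkτ
    have hrτ : r + τ = s + (k + 1) * τ := by rw [hr_def]; ring
    have hrT : r + τ ≤ T' := hrτ ▸ hk1
    have hrlt : r < r + τ := lt_add_of_pos_right r hτ
    have hsub : Set.Icc r (r + τ) ⊆ Set.Icc s T' := Set.Icc_subset_Icc hsr hrT
    have hφ' : Torus.IsClassicalScalarTransportOn (Set.Icc r (r + τ)) κ u φ :=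
      hφ.restrict_Icc hrlt hsub
    have hφr : φ r ∈ S := hInv0 s T' hs φ hφ hφs r ⟨hsr, le_trans (le_of_lt hrlt) hrT⟩
    have hhalf := hHalf r hr0 φ hφ' hφr
    have ihk := ih (le_trans (le_of_lt hrlt) hrT)
    rw [← hrτ]
    calc √(Torus.scalarL2Sq (φ (r + τ)))
        ≤ √(4⁻¹ * Torus.scalarL2Sq (φ r)) := Real.sqrt_le_sqrt hhalf
      _ = 2⁻¹ * √(Torus.scalarL2Sq (φ r)) := by
          rw [Real.sqrt_mul' _ (Torus.scalarL2Sq_nonneg _),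
            show (4⁻¹ : ℝ) = (2⁻¹) ^ 2 by norm_num, Real.sqrt_sq (by norm_num)]
      _ ≤ 2⁻¹ * ((2⁻¹ : ℝ) ^ k * √(Torus.scalarL2Sq (φ s))) :=
          mul_le_mul_of_nonneg_left ihk (by norm_num)
      _ = (2⁻¹ : ℝ) ^ (k + 1) * √(Torus.scalarL2Sq (φ s)) := by rw [pow_succ]; ring

/-! ## The stub: the input-power floor after the lag `nτ` -/

/-- **S3 `stub_inputPowerFloor` (line `budgeted-mixer-template`, crux
`TwoAndHalfD.ScalarAnomalySteadySourceFormal`).** Let `κ > 0`, `τ > 0`, `n ≥ 1`, `u` a jointly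
smooth divergence-free drift on `T² × [0, ∞)`, `h` a smooth profile and `S` a class of profiles
with (small) `4τ‖h‖² ≤ 2ⁿc₀`, (Half) every classical release `∂ₜφ + u·∇φ = κΔφ` on `[s, s + τ]`,
`s ≥ 0`, with `φ(s) ∈ S` has `‖φ(s + τ)‖² ≤ ¼‖φ(s)‖²`, (Inv-0) classical releases on `[s, T']`,
`s ≥ 0`, with datum in `S` stay in `S`, and (Floor) every classical solution of
`∂ₜρ + u·∇ρ = κΔρ + h` on `[s, s + nτ]`, `s ≥ 0`, with `ρ(s) = 0` has `∫ h·ρ(s + nτ) ≥ c₀`. Then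
every global classical solution `θ` of the `h`-sourced equation on `[0, ∞)` with `θ(t) ∈ S` and
`‖θ(t)‖² ≤ 4τ²‖h‖²` for `t ≥ 0` has `∫ h θ(t) ≥ c₀/2` for all `t ≥ nτ`. Proof: write `t = s + nτ`,
`s ≥ 0`; split `θ = φ + ρ` on `[s, t]` with `φ` the release from `θ(s)` (`exists_release_Icc`) and
`ρ = θ - φ` the cold start at `s` (`forced_restrict`, `forced_sub_unforced`), so that (Floor) gives
`∫ h·ρ(t) ≥ c₀`; iterated halving (`sqrt_scalarL2Sq_release_le`) and the restart bound give
`‖φ(t)‖ ≤ 2^{-n}·2τ‖h‖`, so by Cauchy–Schwarz (`integral_mul_le_sqrt_mul_sqrt`) and (small)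
`-∫ h·φ(t) ≤ 2^{-n}·2τ‖h‖² ≤ c₀/2`; finally `∫ h·θ(t) = ∫ h·φ(t) + ∫ h·ρ(t) ≥ c₀/2`. Honest at
every fixed `κ` (finite window `[t - nτ, t]`, no limsup); the certifiable form of the card's K3
(Green–Kubo / no-revival). [folklore] -/
theorem stub_inputPowerFloor :
    ∀ (κ τ c₀ : ℝ) (n : ℕ) (u : ℝ → UnitAddTorus (Fin 2) → EuclideanSpace ℝ (Fin 2))
      (h : UnitAddTorus (Fin 2) → ℝ) (S : Set (UnitAddTorus (Fin 2) → ℝ))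
      (θ : ℝ → UnitAddTorus (Fin 2) → ℝ),
      0 < κ → 0 < τ → 1 ≤ n →
      Torus.IsSmoothSpaceTimeOn (Set.Ici 0) u → (∀ t ∈ Set.Ici (0 : ℝ), Torus.IsDivFree (u t)) →
      Torus.IsSmooth h →
      4 * τ * Torus.scalarL2Sq h ≤ 2 ^ n * c₀ →
      (∀ (s : ℝ), 0 ≤ s → ∀ φ : ℝ → UnitAddTorus (Fin 2) → ℝ,
          Torus.IsClassicalScalarTransportOn (Set.Icc s (s + τ)) κ u φ → φ s ∈ S →
          Torus.scalarL2Sq (φ (s + τ)) ≤ 4⁻¹ * Torus.scalarL2Sq (φ s)) →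
      (∀ (s T' : ℝ), 0 ≤ s → ∀ φ : ℝ → UnitAddTorus (Fin 2) → ℝ,
          Torus.IsClassicalScalarTransportOn (Set.Icc s T') κ u φ → φ s ∈ S →
          ∀ t ∈ Set.Icc s T', φ t ∈ S) →
      (∀ (s : ℝ), 0 ≤ s → ∀ ρ : ℝ → UnitAddTorus (Fin 2) → ℝ,
          Torus.IsClassicalScalarTransportForcedOn (Set.Icc s (s + n * τ)) κ u (fun _ => h) ρ →
          ρ s = (fun _ => (0 : ℝ)) → c₀ ≤ ∫ x, h x * ρ (s + n * τ) x) →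
      Torus.IsClassicalScalarTransportForcedOn (Set.Ici 0) κ u (fun _ => h) θ →
      (∀ t, 0 ≤ t → θ t ∈ S) →
      (∀ t, 0 ≤ t → Torus.scalarL2Sq (θ t) ≤ 4 * τ ^ 2 * Torus.scalarL2Sq h) →
      ∀ t, n * τ ≤ t → c₀ / 2 ≤ ∫ x, h x * θ t x := by
  intro κ τ c₀ n u h S θ hκ hτ hn hu hdiv hh hsmall hHalf hInv0 hFloor hθ hS hVar t ht
  -- the window `[s, t]`, `s = t - nτ ≥ 0`
  obtain ⟨s, rfl⟩ : ∃ s, t = s + n * τ := ⟨t - n * τ, (sub_add_cancel t _).symm⟩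
  have hnpos : (0 : ℝ) < n := Nat.cast_pos.mpr hn
  have hnτ : 0 < (n : ℝ) * τ := mul_pos hnpos hτ
  have hs : 0 ≤ s := by linarith
  have hslt : s < s + n * τ := lt_add_of_pos_right s hnτ
  have hsub : Set.Icc s (s + n * τ) ⊆ Set.Ici 0 := fun r hr => hs.trans hr.1
  have ht0 : (0 : ℝ) ≤ s + n * τ := hs.trans hslt.le
  -- (1) the release `φ` from `θ(s)` on `[s, s + nτ]`
  have hθs : Torus.IsSmooth (θ s) := hθ.smooth_scalar.isSmooth_slice (show (0 : ℝ) ≤ s from hs)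
  obtain ⟨φ, hφ, hφs⟩ := exists_release_Icc hκ hnτ hu hdiv hs hθs
  have hφS : φ s ∈ S := by
    rw [hφs]
    exact hS s hs
  -- (2) the cold-start remainder `ρ = θ - φ` and the floor
  have hθ' := forced_restrict hθ hsub (uniqueDiffOn_Icc hslt)
  have hρ := forced_sub_unforced (uniqueDiffOn_Icc hslt) hθ' hφ
  have hρ0 : (fun r x => θ r x - φ r x) s = fun _ => 0 := by
    funext x
    simp [hφs]
  have hfloor : c₀ ≤ ∫ x, h x * (θ (s + n * τ) x - φ (s + n * τ) x) :=
    hFloor s hs (fun r x => θ r x - φ r x) hρ hρ0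
  -- (3) iterated halving and the restart bound: `‖φ(t)‖ ≤ 2⁻ⁿ · 2τ‖h‖`
  have hiter := sqrt_scalarL2Sq_release_le hτ hs hHalf hInv0 hφ hφS n le_rfl
  rw [hφs] at hiter
  set H : ℝ := Torus.scalarL2Sq h with hH_def
  have hH0 : 0 ≤ H := Torus.scalarL2Sq_nonneg _
  set A : ℝ := √H with hA_def
  have hA0 : 0 ≤ A := Real.sqrt_nonneg _
  have hA2 : A ^ 2 = H := Real.sq_sqrt hH0
  have hθsA : √(Torus.scalarL2Sq (θ s)) ≤ 2 * τ * A := by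
    rw [Real.sqrt_le_left (by positivity)]
    calc Torus.scalarL2Sq (θ s) ≤ 4 * τ ^ 2 * H := hVar s hs
      _ = (2 * τ * A) ^ 2 := by rw [← hA2]; ring
  set q : ℝ := (2⁻¹ : ℝ) ^ n with hq_def
  have hq0 : 0 ≤ q := by positivity
  have hq1 : 2 ^ n * q = 1 := by
    rw [hq_def, ← mul_pow, mul_inv_cancel₀ (two_ne_zero' ℝ), one_pow]
  have hφtA : √(Torus.scalarL2Sq (φ (s + n * τ))) ≤ q * (2 * τ * A) :=
    hiter.trans (mul_le_mul_of_nonneg_left hθsA hq0)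
  -- (4) Cauchy–Schwarz: `-∫ h·φ(t) ≤ ‖h‖ ‖φ(t)‖ ≤ c₀ / 2`
  have hφt : Torus.IsSmooth (φ (s + n * τ)) :=
    hφ.smooth_scalar.isSmooth_slice (Set.right_mem_Icc.2 hslt.le)
  have hcs := integral_mul_le_sqrt_mul_sqrt (f := fun x => -h x) (hh.neg.memLp 2) (hφt.memLp 2)
  simp only [neg_mul, integral_neg, neg_sq] at hcs
  change -∫ x, h x * φ (s + n * τ) x ≤ A * √(Torus.scalarL2Sq (φ (s + n * τ))) at hcs
  have hkey : A * √(Torus.scalarL2Sq (φ (s + n * τ))) ≤ c₀ / 2 := by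
    calc A * √(Torus.scalarL2Sq (φ (s + n * τ)))
        ≤ A * (q * (2 * τ * A)) := mul_le_mul_of_nonneg_left hφtA hA0
      _ = q / 2 * (4 * τ * H) := by rw [← hA2]; ring
      _ ≤ q / 2 * (2 ^ n * c₀) := mul_le_mul_of_nonneg_left hsmall (by positivity)
      _ = (2 ^ n * q) * c₀ / 2 := by ring
      _ = c₀ / 2 := by rw [hq1, one_mul]
  -- (5) `∫ h θ(t) = ∫ h φ(t) + ∫ h ρ(t)`
  have hθt : Torus.IsSmooth (θ (s + n * τ)) := hθ.smooth_scalar.isSmooth_slice ht0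
  have i1 : Integrable (fun x => h x * φ (s + n * τ) x) volume :=
    (hh.continuous.mul hφt.continuous).integrable_unitAddTorus
  have i2 : Integrable (fun x => h x * (θ (s + n * τ) x - φ (s + n * τ) x)) volume :=
    (hh.continuous.mul (hθt.continuous.sub hφt.continuous)).integrable_unitAddTorus
  have hsplit : ∫ x, h x * θ (s + n * τ) x =
      (∫ x, h x * φ (s + n * τ) x) + ∫ x, h x * (θ (s + n * τ) x - φ (s + n * τ) x) := by
    rw [← integral_add i1 i2]
    refine integral_congr_ae (Eventually.of_forall fun x => ?_)
    ring
  rw [hsplit]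
  linarith [hcs, hkey, hfloor]

end Summit.AnomalousDissipation.AnomalousDissipation.Theorems.ScalarAnomalySteadySourceFormal.InputPowerFloor

end
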